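import Mathlib
import HarnessLib
import Summits.HubbardSuperconductivity.HubbardSuperconductivity.Theorems.KLProgrammeKLRegimeWickLegDressing

/-!
# Route `KLProgramme` — ENGINE child (stmt-HubbardSuperconductivity-19918 `KLRegimeEngineV14` / its gen-6 successor), stub `stub_engine_step_values`,
# conjunct (E2-v9): the one-line Wick term of the MODEL = external-leg dressing by the Wick self-energy
# (E2-WICK-ROADMAP §5 (iii-e), model half; cell gate-hubbard-kl, seat p1 g9; sequel to `…WickLegDressing`)

`kernel_dblFold_oneLine_self` (p504589) writes the `4`-leg kernel of `dblFold(Δ_×(C)(𝒲⁰𝒲¹))` at labels `Z` as `4·(−T₀ + T₁ − T₂ + T₃)`,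
`T_i = Σ_{X,Y} contr C X Y · kernel 𝒲 2 (X, Z_i) · kernel 𝒲 4 (Y, Z without Z_i)`.  For a DIAGONAL line (`contr ℂ C = diagContr ℓ`, p499749) and the
Wick action `𝒲_n` the two-leg kernel pairs only reciprocal labels (`kernel_klWickAction_two_plus/minus_eq_zero`, p503245), so the line must end on
the reciprocal of the external leg `Z_i = ψ̂^±_{p_iσ_i}`, for EITHER charge:
`T_i = ℓ(p_i)·kernel 𝒲_n 2 (ψ̂⁻_{p_iσ_i}, ψ̂⁺_{p_iσ_i})·kernel 𝒲_n 4 (Z_i, Z without Z_i)` (`oneLineSum_diagContr`), and putting `Z_i` back in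
place costs `(−1)^i`.  Hence **`vertexFn_dblFold_oneLine`**: for ANY four external legs `Z`,
`𝒱₄(dblFold(Δ_×(C)(𝒲_n⁰·𝒲_n¹)))(Z) = 2·(βL²)⁻¹·𝒱₄(𝒲_n)(Z)·Σ_{i<4} ℓ(p_i)·Σ^W_n(p_i, σ_i)` (`Σ^W = klWickSelfEnergy`) — every external leg
dressed by (line value at its own momentum) × (Wick self-energy there).  With the slice line `ℓ = ℓ_{g_{n+1}}` (the `j = 1` term of
`klw_wickPairAmplitude_succ_lines`, p504266) only legs on the slice support contribute: the `legDressBarQ·legSliceCountT` line of (E2-v9), exact.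

Proved; no definitions; exact identities; nothing about sizes is asserted.
-/

noncomputable section

namespace Summit.HubbardSuperconductivity.HubbardSuperconductivity.Theorems.KLRegimeWick

set_option linter.dupNamespace false -- summit = problem name (single-conjunct summit), D-0017

open Literature.MathematicalPhysics.QuantumLattice GrassmannAlgebra Finset Matrix
open Literature.Probability.LatticeModels
open Summit.HubbardSuperconductivity.HubbardSuperconductivity.Theorems.TwoPointAssembly
open Summit.HubbardSuperconductivity.HubbardSuperconductivity.Theorems.KLProgrammeLegKernels
open Summit.HubbardSuperconductivity.HubbardSuperconductivity.Theorems.KLRegimeSplit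

section Model

variable {L M : ℕ} [NeZero L] [NeZero M] (β U μ : ℝ) (K : TrigPolyC4v)

omit [NeZero L] [NeZero M] in
/-- Moving leg `2` to the front (a 3-cycle) keeps a `4`-leg kernel. -/
theorem kernel_four_rot3 (W : HubbardGrassmann L M) (A B C D : HubbardFieldIdx L M) :
    kernel ℂ W 4 ![C, A, B, D] = kernel ℂ W 4 ![A, B, C, D] := by
  let σ : Equiv.Perm (Fin 4) := ⟨![2, 0, 1, 3], ![1, 2, 0, 3], by decide, by decide⟩
  have hσ : Equiv.Perm.sign σ = 1 := by decide
  have h : (![C, A, B, D] : Fin 4 → HubbardFieldIdx L M) = ![A, B, C, D] ∘ σ := by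
    funext i; fin_cases i <;> rfl
  rw [h, kernel_comp_perm, hσ]
  simp

omit [NeZero L] [NeZero M] in
/-- Moving leg `3` to the front (a 4-cycle) negates a `4`-leg kernel. -/
theorem kernel_four_rot4 (W : HubbardGrassmann L M) (A B C D : HubbardFieldIdx L M) :
    kernel ℂ W 4 ![D, A, B, C] = -kernel ℂ W 4 ![A, B, C, D] := by
  let σ : Equiv.Perm (Fin 4) := ⟨![3, 0, 1, 2], ![1, 2, 3, 0], by decide, by decide⟩
  have hσ : Equiv.Perm.sign σ = -1 := by decide
  have h : (![D, A, B, C] : Fin 4 → HubbardFieldIdx L M) = ![A, B, C, D] ∘ σ := by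
    funext i; fin_cases i <;> rfl
  rw [h, kernel_comp_perm, hσ]
  simp

/-- **`oneLineSum_diagContr`** — against a diagonal line the one-line sum localises on the external leg: for either charge of `Zi = ψ̂^±_{pσ}`,
`Σ_{X,Y} diagContr ℓ X Y · kernel 𝒲_n 2 (X, Zi) · kernel 𝒲_n 4 (Y, R) = ℓ(p)·kernel 𝒲_n 2 (ψ̂⁻_{pσ}, ψ̂⁺_{pσ})·kernel 𝒲_n 4 (Zi, R)`. -/
theorem oneLineSum_diagContr (ℓ : FreqMomentum L M → ℂ) (n : ℕ) (Zi : HubbardFieldIdx L M) (R : Fin 3 → HubbardFieldIdx L M) :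
    ∑ X, ∑ Y, diagContr L M ℓ X Y * (kernel ℂ (klWickAction L M β U μ K n) 2 ![X, Zi] * kernel ℂ (klWickAction L M β U μ K n) 4 (Matrix.vecCons Y R)) =
      ℓ Zi.1.1 * (kernel ℂ (klWickAction L M β U μ K n) 2 ![(Zi.1, 1), (Zi.1, 0)] *
        kernel ℂ (klWickAction L M β U μ K n) 4 (Matrix.vecCons Zi R)) := by
  set W := klWickAction L M β U μ K n with hW
  rw [sum_diagContr_mul]
  obtain ⟨⟨q, τ⟩, c⟩ := Zi
  -- the two-leg kernel pairs only reciprocal labels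
  have hmm : ∀ (p : FreqMomentum L M) (σ : Fin 2), kernel ℂ W 2 ![((p, σ), 1), ((q, τ), 1)] = 0 :=
    fun p σ => kernel_klWickAction_two_minus_eq_zero β U μ K n p σ (by simp)
  have hpp : ∀ (p : FreqMomentum L M) (σ : Fin 2), kernel ℂ W 2 ![((p, σ), 0), ((q, τ), 0)] = 0 :=
    fun p σ => kernel_klWickAction_two_plus_eq_zero β U μ K n p σ (by simp)
  fin_cases c
  · -- `Zi = ψ̂⁺_{qτ}`: only the `ψ̂⁻` end of the line can sit on it
    simp only [Fin.zero_eta, Fin.isValue, hpp, zero_mul, sub_zero]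
    rw [← Fintype.sum_prod_type']
    rw [Finset.sum_eq_single (((q, τ)) : FreqMomentum L M × Fin 2) (fun x _ hx => ?_) (fun h => absurd (Finset.mem_univ _) h)]
    obtain ⟨p, σ⟩ := x
    dsimp only
    rw [kernel_klWickAction_two_minus_eq_zero β U μ K n p σ (fun h => hx (by simpa using h.symm)), zero_mul, mul_zero]
  · -- `Zi = ψ̂⁻_{qτ}`: only the `ψ̂⁺` end
    simp only [Fin.mk_one, Fin.isValue, hmm, zero_mul, zero_sub, mul_neg]
    rw [← Fintype.sum_prod_type']
    rw [Finset.sum_eq_single (((q, τ)) : FreqMomentum L M × Fin 2) (fun x _ hx => ?_) (fun h => absurd (Finset.mem_univ _) h)]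
    · dsimp only
      rw [kernel_two_swap01 W ((q, τ), 1) ((q, τ), 0)]
      ring
    · obtain ⟨p, σ⟩ := x
      dsimp only
      rw [kernel_klWickAction_two_plus_eq_zero β U μ K n p σ (fun h => hx (by simpa using h.symm)), zero_mul, mul_zero, neg_zero]

/-- **`vertexFn_dblFold_oneLine` — external-leg dressing, exactly.**  For the Wick action `𝒲_n`, any diagonal line `C` (values `ℓ`) and ANY four
external legs `Z = (ψ̂^{c_i}_{p_iσ_i})_{i<4}`:
`𝒱₄(dblFold(Δ_×(C)(𝒲_n⁰·𝒲_n¹)))(Z) = 2·(βL²)⁻¹ · 𝒱₄(𝒲_n)(Z) · Σ_{i<4} ℓ(p_i)·Σ^W_n(p_i, σ_i)`. -/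
theorem vertexFn_dblFold_oneLine (hβ : β ≠ 0) {C : Matrix (HubbardFieldIdx L M) (HubbardFieldIdx L M) ℂ} {ℓ : FreqMomentum L M → ℂ}
    (hC : contr ℂ C = diagContr L M ℓ) (n : ℕ) (Z : Fin 4 → HubbardFieldIdx L M) :
    vertexFn L M β (dblFold ℂ (grassmannLaplacian ℂ (crossCov ℂ C)
        (dblCopy ℂ 0 (klWickAction L M β U μ K n) * dblCopy ℂ 1 (klWickAction L M β U μ K n)))) 4 Z =
      2 * (((β * (L : ℝ) ^ 2 : ℝ) : ℂ))⁻¹ * vertexFn L M β (klWickAction L M β U μ K n) 4 Z *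
        ∑ i : Fin 4, ℓ (Z i).1.1 * klWickSelfEnergy L M β U μ K n (Z i).1.1 (Z i).1.2 := by
  have hL : (L : ℝ) ≠ 0 := Nat.cast_ne_zero.2 (NeZero.ne L)
  have hb : (((β * (L : ℝ) ^ 2 : ℝ) : ℂ)) ≠ 0 := by exact_mod_cast mul_ne_zero hβ (pow_ne_zero 2 hL)
  obtain ⟨e4, -, e2⟩ := vertexFn_consts_eq (L := L) β
  set W := klWickAction L M β U μ K n with hW
  have hZ : (![Z 0, Z 1, Z 2, Z 3] : Fin 4 → HubbardFieldIdx L M) = Z := by funext i; fin_cases i <;> rfl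
  rw [vertexFn_def, show (4 - 1 : ℕ) = 3 from rfl, kernel_dblFold_oneLine_self ℂ C (klw_wickAction_mem_evenOdd_zero L M β U μ K n) Z, hC,
    oneLineSum_diagContr β U μ K ℓ n (Z 0) ![Z 1, Z 2, Z 3], oneLineSum_diagContr β U μ K ℓ n (Z 1) ![Z 0, Z 2, Z 3],
    oneLineSum_diagContr β U μ K ℓ n (Z 2) ![Z 0, Z 1, Z 3], oneLineSum_diagContr β U μ K ℓ n (Z 3) ![Z 0, Z 1, Z 2]]
  rw [show (Matrix.vecCons (Z 0) ![Z 1, Z 2, Z 3] : Fin 4 → HubbardFieldIdx L M) = ![Z 0, Z 1, Z 2, Z 3] from rfl,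
    show (Matrix.vecCons (Z 1) ![Z 0, Z 2, Z 3] : Fin 4 → HubbardFieldIdx L M) = ![Z 1, Z 0, Z 2, Z 3] from rfl,
    show (Matrix.vecCons (Z 2) ![Z 0, Z 1, Z 3] : Fin 4 → HubbardFieldIdx L M) = ![Z 2, Z 0, Z 1, Z 3] from rfl,
    show (Matrix.vecCons (Z 3) ![Z 0, Z 1, Z 2] : Fin 4 → HubbardFieldIdx L M) = ![Z 3, Z 0, Z 1, Z 2] from rfl,
    kernel_four_swap01 W (Z 0) (Z 1), kernel_four_rot3 W (Z 0) (Z 1) (Z 2), kernel_four_rot4 W (Z 0) (Z 1) (Z 2), hZ]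
  simp only [Fin.sum_univ_four, klWickSelfEnergy, selfEnergy, hW]
  rw [kernel_two_swap01 _ ((Z 0).1, 0) ((Z 0).1, 1), kernel_two_swap01 _ ((Z 1).1, 0) ((Z 1).1, 1),
    kernel_two_swap01 _ ((Z 2).1, 0) ((Z 2).1, 1), kernel_two_swap01 _ ((Z 3).1, 0) ((Z 3).1, 1),
    kernel_two_eq_inv_mul_vertexFn β hβ, kernel_two_eq_inv_mul_vertexFn β hβ, kernel_two_eq_inv_mul_vertexFn β hβ,
    kernel_two_eq_inv_mul_vertexFn β hβ, kernel_four_eq_inv_mul_vertexFn β hβ, e4, e2]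
  simp only [Prod.mk.eta]
  field_simp
  ring

end Model

end Summit.HubbardSuperconductivity.HubbardSuperconductivity.Theorems.KLRegimeWick

end
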